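import Summits.QuantumFields.BalabanUV.Beta.EriceFlowEnclosureInverseLawThird
import Summits.QuantumFields.BalabanUV.Beta.EriceFlowEnclosureModulusTails

/-!
# Beta / EriceFlowEnclosureInverseLawFiveHalves — INVERSION OF A LOGARITHMIC LAW AT HALF-INTEGER PRECISION (pure SERVICE, P2 #36c's
# companion for the literal road): from `|Λ t − 1∕t − κ·log t − C − a·t| ≤ A·t·√t` on ]0, t₁[ (the Λ-law road (G) gives, P2 #44d) and an
# eventual right inverse σ → 0⁺ with `y·σ y → 1`:
#     **eventually |1∕σ y − y − κ·log y + C − κ²·(log y)∕y + (κ·C + a)∕y| ≤ A‴ · 1∕(y·√y)**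
# — THE 1∕y LETTER −(κC + a) OF THE RUNNING COUPLING SURVIVES AT PRECISION y^{−3∕2} (P2 #36c `inverse_law_third` needs the O(t²(1+|log t|)²)
# Λ-error of road (S) ∕ (T₃) and returns (1 + log y)²∕y²), and the letter is FORCED at this precision
# (β-flow team, prover 2 = lower ∕ positivity side, unit `b2b-balaban-beta-bflow-p2`, gen 27; module P2 #44e over P2 #36c
# `EriceFlowEnclosureInverseLawThird` (its abstract identity `inverse_third_identity` and five-term bound `inverse_third_remainder_le` consumed BY
# NAME with the E₃-slot set to zero; `abs_log_sub_le_of_inv_eq`) and P2 #44-A `EriceFlowEnclosureModulusTails` (`logSq_div_sq_le_inv_sqrt`: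
# (1 + log y)²∕y² ≤ 16∕(y√y)); consumer P2 #44f `EriceFlowEnclosureRunningCouplingFiveHalves`)

HONEST FRAMING (page 1 of everything the β sub-cell writes): discharging `BetaPertH` makes Bałaban's UV stability UNCONDITIONAL — a
real constructive-QFT result; it is NOT the continuum limit and NOT the Clay problem.  HONEST DEPENDENCY (cell reorg 2026-08-19,
verbatim): «continuum YM on T⁴ ⇐ BetaPertH ∧ nine spine estimates (0/9 proved); BetaPertH ⇐ (D1) ∧ (D4) ∧ CAP+tail; G-an2-4 gates
asym, D1 and NE2/3/4.»  THIS MODULE DISCHARGES NOTHING and quotes nothing: [folklore] real analysis about two real functions Λ, σ and six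
real letters; no Erice sentence occurs (the consumer P2 #44f supplies the Λ-law from road (G)).

THE POINT.  P2 #36c's route at t = σ y: E := y − 1∕t − κ log t − C = a·t + E₃, now with |E₃| ≤ A·t√t ≤ 3A∕(y√y) (t ≤ 2∕y, √2 ≤ 3∕2);
u := (C + κ log t + E)∕y, 1∕(yt) = 1 − u, log(yt) = u + r, |r| ≤ 2u²; the exact rearrangement `inverse_third_identity` leaves
`−κ²(u + r)∕y − κE∕y − κr − a·t·u − E₃`; the first four terms are O((1 + log y)²∕y²) by `inverse_third_remainder_le` (E₃-slot := 0), and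
(1 + log y)²∕y² ≤ 16∕(y√y) (P2 #44-A) merges them with |E₃| ≤ 3A∕(y√y).

WHAT THIS FILE PROVES (0 sorry, 0 def): `t_sqrt_le_of_le_two_div` (t ≤ 2∕y ⟹ t√t ≤ 3∕(y√y)), HEADLINE **`inverse_law_fiveHalves`**
(statement above; A‴ = 16·(κ²B + κ²B² + |κ|A₀ + 2|κ|B² + 2|a|B) + 3A, A₀ = 2|a| + 3A, B = |C| + |κ| + A₀, DISPLAYED), and
**`invLetter_unique_fiveHalves`** (two expansions `b∕y + O(1∕(y√y))` of one function agree: the 1∕y letter is FORCED at this precision).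
NOT CLAIMED: the Λ-law itself (a HYPOTHESIS here); anything about (1.22); `BetaPertH`; continuum; Clay.
-/

namespace Summit.QuantumFields.BalabanUV.Beta.EriceFlowEnclosureInverseLawFiveHalves

open Set Filter Topology
open Summit.QuantumFields.BalabanUV.Beta.EriceFlowEnclosureInverseLawThird (abs_log_sub_le_of_inv_eq inverse_third_identity
  inverse_third_remainder_le)
open Summit.QuantumFields.BalabanUV.Beta.EriceFlowEnclosureModulusTails (logSq_div_sq_le_inv_sqrt)

noncomputable section

/-- For `0 < y` and `t ≤ 2∕y`: `t·√t ≤ 3∕(y·√y)` (`(2∕y)·√(2∕y) = 2√2∕(y√y)`, `2√2 ≤ 3`; the numerical fact `√2 ≤ 3∕2` is the tree's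
`Literature.Analysis.FluidPDE.Tao2016.sqrt_two_le`, re-derived inline here to keep this file's imports inside the lineage). [folklore] -/
theorem t_sqrt_le_of_le_two_div {t y : ℝ} (hy : 0 < y) (ht : t ≤ 2 / y) :
    t * Real.sqrt t ≤ 3 / (y * Real.sqrt y) := by
  have sqrt_two_le : Real.sqrt 2 ≤ 3 / 2 := by
    have h : Real.sqrt 2 ≤ Real.sqrt ((3 / 2) ^ 2) := Real.sqrt_le_sqrt (by norm_num)
    rwa [Real.sqrt_sq (by norm_num : (0 : ℝ) ≤ 3 / 2)] at h
  have hsy : 0 < Real.sqrt y := Real.sqrt_pos.mpr hy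
  have h1 : t * Real.sqrt t ≤ (2 / y) * Real.sqrt (2 / y) :=
    mul_le_mul ht (Real.sqrt_le_sqrt ht) (Real.sqrt_nonneg t) (by positivity)
  have h2 : Real.sqrt (2 / y) = Real.sqrt 2 / Real.sqrt y := Real.sqrt_div' 2 hy.le
  rw [h2] at h1
  refine h1.trans ?_
  rw [div_mul_div_comm, div_le_div_iff₀ (by positivity) (by positivity)]
  nlinarith [sqrt_two_le, hsy, hy, mul_pos hy hsy]
set_option maxHeartbeats 400000 in
/-- **INVERSION AT HALF-INTEGER PRECISION (HEADLINE; pure real analysis): the coefficient of 1∕y is −(κC + a), error O(1∕(y√y)).**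
If `|Λ t − 1∕t − κ·log t − C − a·t| ≤ A·t·√t` on ]0, t₁[ (A ≥ 0, t₁ > 0), σ is an eventual right inverse of Λ with `σ y → 0⁺` and
`y·σ y → 1`, then eventually `|1∕σ y − y − κ·log y + C − κ²·(log y)∕y + (κ·C + a)∕y| ≤ A‴ · 1∕(y·√y)`,
A‴ = 16·(κ²B + κ²B² + |κ|A₀ + 2|κ|B² + 2|a|B) + 3A, A₀ = 2|a| + 3A, B = |C| + |κ| + A₀ — P2 #36c `inverse_law_third` re-run with the
E₃-bracket `|E₃| ≤ A·t√t ≤ 3A∕(y√y)` and (1 + log y)²∕y² ≤ 16∕(y√y). [folklore] -/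
theorem inverse_law_fiveHalves {Λ σ : ℝ → ℝ} {κ C a A t₁ : ℝ} (hA : 0 ≤ A)
    (hlaw : ∀ t ∈ Ioo 0 t₁, |Λ t - 1 / t - κ * Real.log t - C - a * t| ≤ A * (t * Real.sqrt t))
    (hσ0 : Tendsto σ atTop (𝓝[>] 0)) (hσ : ∀ᶠ y in atTop, Λ (σ y) = y)
    (hone : Tendsto (fun y => y * σ y) atTop (𝓝 1)) (ht₁ : 0 < t₁) :
    ∀ᶠ y in atTop, |1 / σ y - y - κ * Real.log y + C - κ ^ 2 * Real.log y / y + (κ * C + a) / y|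
      ≤ (16 * (κ ^ 2 * (|C| + |κ| + (2 * |a| + 3 * A)) + κ ^ 2 * (|C| + |κ| + (2 * |a| + 3 * A)) ^ 2
          + |κ| * (2 * |a| + 3 * A) + 2 * |κ| * (|C| + |κ| + (2 * |a| + 3 * A)) ^ 2
          + 2 * |a| * (|C| + |κ| + (2 * |a| + 3 * A))) + 3 * A) * (1 / (y * Real.sqrt y)) := by
  -- adapted from P2 #36c `EriceFlowEnclosureInverseLawThird.inverse_law_third` (same letters; E₃-bracket and the final merge differ)
  have hmem : ∀ᶠ y in atTop, σ y ∈ Ioo 0 t₁ := hσ0 (Ioo_mem_nhdsGT ht₁)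
  have hlo : ∀ᶠ y in atTop, 1 / 2 < y * σ y := hone.eventually (lt_mem_nhds (by norm_num))
  have hhi : ∀ᶠ y in atTop, y * σ y < 2 := hone.eventually (gt_mem_nhds (by norm_num))
  obtain ⟨A₀, hA₀⟩ : ∃ A₀ : ℝ, A₀ = 2 * |a| + 3 * A := ⟨_, rfl⟩
  obtain ⟨B, hB⟩ : ∃ B : ℝ, B = |C| + |κ| + A₀ := ⟨_, rfl⟩
  have hA₀nn : 0 ≤ A₀ := by rw [hA₀]; positivity
  have hB0 : 0 ≤ B := by rw [hB]; positivity
  have hsmallu : ∀ᶠ y : ℝ in atTop, B * (1 + Real.log y) / y ≤ 1 / 2 := by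
    have hlogdiv : Tendsto (fun y : ℝ => Real.log y / y) atTop (𝓝 0) := Real.isLittleO_log_id_atTop.tendsto_div_nhds_zero
    have hinv : Tendsto (fun y : ℝ => 1 / y) atTop (𝓝 0) := tendsto_const_nhds.div_atTop tendsto_id
    have h : Tendsto (fun y : ℝ => B * (1 / y + Real.log y / y)) atTop (𝓝 0) := by
      have := (hinv.add hlogdiv).const_mul B; rwa [add_zero, mul_zero] at this
    have h2 := h.eventually (gt_mem_nhds (by norm_num : (0:ℝ) < 1 / 2))
    filter_upwards [h2, eventually_gt_atTop (0:ℝ)] with y hy hy0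
    have e : B * (1 + Real.log y) / y = B * (1 / y + Real.log y / y) := by field_simp
    rw [e]; exact hy.le
  filter_upwards [hmem, hσ, hlo, hhi, eventually_ge_atTop (2 : ℝ), hsmallu] with y ht he hlo hhi hy2 hsu
  set t := σ y with htdef
  have ht0 : 0 < t := ht.1
  have hy0 : 0 < y := by linarith
  have hy1 : (1 : ℝ) ≤ y := by linarith
  have hsy : 0 < Real.sqrt y := Real.sqrt_pos.mpr hy0
  have hsy1 : 1 ≤ Real.sqrt y := by rw [← Real.sqrt_one]; exact Real.sqrt_le_sqrt hy1
  have hlogy : 0 ≤ Real.log y := Real.log_nonneg (by linarith)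
  obtain ⟨L, hL⟩ : ∃ L : ℝ, L = 1 + Real.log y := ⟨_, rfl⟩
  have hL1 : 1 ≤ L := by rw [hL]; linarith
  have hL2 : L ^ 2 / y ^ 2 ≤ 16 / (y * Real.sqrt y) := by rw [hL]; exact logSq_div_sq_le_inv_sqrt hy1
  have hLaw := hlaw t ht
  rw [he] at hLaw
  have ht_le : t ≤ 2 / y := by rw [le_div_iff₀ hy0]; linarith
  have ht_ge : 1 / (2 * y) ≤ t := by rw [div_le_iff₀ (by linarith)]; linarith
  have htle1 : t ≤ 1 := ht_le.trans (by rw [div_le_one hy0]; linarith)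
  have hlogt : |Real.log t| ≤ Real.log y + 1 := by
    have hneg : Real.log t ≤ 0 := Real.log_nonpos ht0.le htle1
    rw [abs_of_nonpos hneg]
    have h1 : Real.log (1 / (2 * y)) ≤ Real.log t := Real.log_le_log (by positivity) ht_ge
    rw [one_div, Real.log_inv, Real.log_mul (by norm_num) hy0.ne'] at h1
    have h2 : Real.log 2 ≤ 1 := by
      have := Real.log_le_sub_one_of_pos (by norm_num : (0:ℝ) < 2); linarith
    linarith
  -- letters E, E₃, u, r
  set E : ℝ := y - 1 / t - κ * Real.log t - C with hE
  set E₃ : ℝ := E - a * t with hE₃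
  set u : ℝ := (C + κ * Real.log t + E) / y with hu
  set r : ℝ := Real.log (y * t) - u with hr
  have hE₃b : |E₃| ≤ 3 * A / (y * Real.sqrt y) := by
    have h0 : E₃ = y - 1 / t - κ * Real.log t - C - a * t := by simp only [hE₃, hE]
    rw [h0]
    calc |y - 1 / t - κ * Real.log t - C - a * t| ≤ A * (t * Real.sqrt t) := hLaw
      _ ≤ A * (3 / (y * Real.sqrt y)) := mul_le_mul_of_nonneg_left (t_sqrt_le_of_le_two_div hy0 ht_le) hA
      _ = 3 * A / (y * Real.sqrt y) := by ring
  have hE₃b' : |E₃| ≤ 3 * A / y := by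
    refine hE₃b.trans ?_
    rw [div_le_div_iff₀ (by positivity) hy0]
    have : 3 * A * y ≤ 3 * A * (y * Real.sqrt y) := by
      have := le_mul_of_one_le_right hy0.le hsy1
      nlinarith [this, hA]
    linarith
  have hEb : |E| ≤ A₀ / y := by
    have h0 : E = a * t + E₃ := by simp only [hE₃]; ring
    rw [h0, hA₀]
    calc |a * t + E₃| ≤ |a * t| + |E₃| := abs_add_le _ _
      _ ≤ |a| * (2 / y) + 3 * A / y := by
          rw [abs_mul, abs_of_pos ht0]
          exact add_le_add (mul_le_mul_of_nonneg_left ht_le (abs_nonneg a)) hE₃b'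
      _ = (2 * |a| + 3 * A) / y := by ring
  have hEb' : |E| ≤ A₀ := hEb.trans (by rw [div_le_iff₀ hy0]; nlinarith)
  have hub : |u| ≤ B * L / y := by
    rw [hu, abs_div, abs_of_pos hy0]
    refine div_le_div_of_nonneg_right ?_ hy0.le
    calc |C + κ * Real.log t + E| ≤ |C| + |κ * Real.log t| + |E| := abs_add_three _ _ _
      _ ≤ |C| + |κ| * (Real.log y + 1) + A₀ := by
          rw [abs_mul]; exact add_le_add (add_le_add le_rfl (mul_le_mul_of_nonneg_left hlogt (abs_nonneg _))) hEb'
      _ ≤ B * L := by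
          rw [hB, hL]; nlinarith [abs_nonneg C, abs_nonneg κ, mul_nonneg (abs_nonneg C) hlogy, mul_nonneg hA₀nn hlogy]
  have hu_half : |u| ≤ 1 / 2 := hub.trans (by rw [hL]; exact hsu)
  -- 1∕(y t) = 1 − u, log(y t) = u + r with |r| ≤ 2u²
  have hinvw : 1 / (y * t) = 1 - u := by
    have : 1 / t = y - C - κ * Real.log t - E := by simp only [hE]; ring
    rw [hu, one_div, mul_inv, ← one_div t, this]
    field_simp
    ring
  have hrb : |r| ≤ 2 * B ^ 2 * L ^ 2 / y ^ 2 := by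
    have h1 : u ^ 2 ≤ (B * L / y) ^ 2 := by
      rw [← sq_abs u]; exact pow_le_pow_left₀ (abs_nonneg _) hub 2
    calc |r| = |Real.log (y * t) - u| := by rw [hr]
      _ ≤ 2 * u ^ 2 := abs_log_sub_le_of_inv_eq hinvw hu_half
      _ ≤ 2 * (B * L / y) ^ 2 := by linarith
      _ = 2 * B ^ 2 * L ^ 2 / y ^ 2 := by rw [div_pow, mul_pow]; ring
  rw [inverse_third_identity (κ := κ) (C := C) (a := a) ht0 hy0 hE hu hr hE₃]
  -- the four-term part by P2 #36c's abstract bound with the E₃-slot set to zero, plus |E₃| separately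
  have hmain := inverse_third_remainder_le (κ := κ) (a := a) (E₃ := 0) (A := 0) hy2 ht0 ht_le hL1 hB0 hA₀nn hub hrb hEb
    (by rw [abs_zero]; positivity)
  rw [sub_zero] at hmain
  have hsplit : |-(κ ^ 2 * (u + r) / y) - κ * E / y - κ * r - a * t * u - E₃|
      ≤ |-(κ ^ 2 * (u + r) / y) - κ * E / y - κ * r - a * t * u| + |E₃| := abs_sub _ _
  refine hsplit.trans ?_
  have hfour : |-(κ ^ 2 * (u + r) / y) - κ * E / y - κ * r - a * t * u|
      ≤ (κ ^ 2 * B + κ ^ 2 * B ^ 2 + |κ| * A₀ + 2 * |κ| * B ^ 2 + 2 * |a| * B) * (16 / (y * Real.sqrt y)) := by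
    refine hmain.trans ?_
    have hc0 : 0 ≤ κ ^ 2 * B + κ ^ 2 * B ^ 2 + |κ| * A₀ + 2 * |κ| * B ^ 2 + 2 * |a| * B + 16 * 0 := by positivity
    calc (κ ^ 2 * B + κ ^ 2 * B ^ 2 + |κ| * A₀ + 2 * |κ| * B ^ 2 + 2 * |a| * B + 16 * 0) * L ^ 2 / y ^ 2
        = (κ ^ 2 * B + κ ^ 2 * B ^ 2 + |κ| * A₀ + 2 * |κ| * B ^ 2 + 2 * |a| * B + 16 * 0) * (L ^ 2 / y ^ 2) := by ring
      _ ≤ (κ ^ 2 * B + κ ^ 2 * B ^ 2 + |κ| * A₀ + 2 * |κ| * B ^ 2 + 2 * |a| * B + 16 * 0) * (16 / (y * Real.sqrt y)) :=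
          mul_le_mul_of_nonneg_left hL2 hc0
      _ = _ := by ring
  have := add_le_add hfour hE₃b
  refine this.trans (le_of_eq ?_)
  rw [hB, hA₀]
  field_simp

/-- **THE 1∕y LETTER IS UNIQUE AT HALF-INTEGER PRECISION** ([folklore]): if eventually `|G y − b∕y| ≤ A·1∕(y√y)` and
`|G y − b′∕y| ≤ A′·1∕(y√y)`, then `b = b′` (`|b − b′| ≤ (A + A′)∕√y → 0`) — so the letter −(κC + a) of `inverse_law_fiveHalves` is FORCED by the
running coupling. -/
theorem invLetter_unique_fiveHalves {G : ℝ → ℝ} {b b' A A' : ℝ}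
    (h : ∀ᶠ y in atTop, |G y - b / y| ≤ A * (1 / (y * Real.sqrt y)))
    (h' : ∀ᶠ y in atTop, |G y - b' / y| ≤ A' * (1 / (y * Real.sqrt y))) : b = b' := by
  have hdiff : ∀ᶠ y in atTop, |b - b'| ≤ (A + A') * (Real.sqrt y)⁻¹ := by
    filter_upwards [h, h', eventually_ge_atTop (1 : ℝ)] with y hy hy' hy1
    have hy0 : 0 < y := by linarith
    have hsy : 0 < Real.sqrt y := Real.sqrt_pos.mpr hy0
    have h1 : |b / y - b' / y| ≤ (A + A') * (1 / (y * Real.sqrt y)) := by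
      calc |b / y - b' / y| = |(G y - b' / y) - (G y - b / y)| := by ring_nf
        _ ≤ |G y - b' / y| + |G y - b / y| := abs_sub _ _
        _ ≤ A' * (1 / (y * Real.sqrt y)) + A * (1 / (y * Real.sqrt y)) := add_le_add hy' hy
        _ = (A + A') * (1 / (y * Real.sqrt y)) := by ring
    have e1 : |b / y - b' / y| = |b - b'| / y := by
      rw [← sub_div, abs_div, abs_of_pos hy0]
    rw [e1, div_le_iff₀ hy0] at h1
    have e2 : (A + A') * (1 / (y * Real.sqrt y)) * y = (A + A') * (Real.sqrt y)⁻¹ := by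
      field_simp
    rw [e2] at h1
    exact h1
  have hlim : Tendsto (fun y : ℝ => (A + A') * (Real.sqrt y)⁻¹) atTop (𝓝 ((A + A') * 0)) :=
    (tendsto_inv_atTop_zero.comp Real.tendsto_sqrt_atTop).const_mul _
  rw [mul_zero] at hlim
  have := ge_of_tendsto hlim hdiff
  have h0 : |b - b'| = 0 := le_antisymm this (abs_nonneg _)
  linarith [abs_eq_zero.mp h0]

end

end Summit.QuantumFields.BalabanUV.Beta.EriceFlowEnclosureInverseLawFiveHalves
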